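import Summits.ValiantsHypothesis.ValiantsHypothesis.Theorems.SymPencilPerFourRowNoLinearFactor
import Summits.ValiantsHypothesis.ValiantsHypothesis.Theorems.SymPencilPerFourHyperplaneQuad
import Summits.ValiantsHypothesis.ValiantsHypothesis.Theorems.SymPencilPerFourRestrictedQuad

/-!
# Route `SymPencil` — exact flows of `per [v; ·]` on a hyperplane: the OFF-DIAGONAL BLOCKS
# (tool file for the one-row defect-2 cell `(12,4,2)` of `sdc(per_4)`, `--supports`
# stmt-ValiantsHypothesis-5674; nothing here bears on `VP ≠ VNP`)

Step (a) of val-width-5674-w2 g2's stub S1b for the hyperplane flow rigidity (RIG) of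
`F_v(y) = per [v; y 0; y 1; y 2]` (CELL-TWELVE-FOUR.md §2–§3).  If the first-order quantity
`DF_v(y)[X y]` vanishes on `ker ℓ` and the linear form `ℓ` sees row `2` (`ℓ(e₂ ⊗ t) = 1`), then the blocks of
`X` INTO ROW `0` from the rows `1, 2` are rank one through `ℓ`:

* `firstOrder_row0via2_expand`, `row0via2_coeffs` — the test matrices `y' = (0, y₁, τ y₂ + s t)`,
  `s = −(ℓ(e₁⊗y₁) + τ ℓ(e₂⊗y₂))`, lie in `ker ℓ`; `DF_v(y')[X y']` is an explicit cubic in `τ` (by `ring`) and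
  its coefficients vanish (`cubic_coeffs_eq_zero`).
* **`offDiag_row0_via2`** — `(X (e₁ ⊗ y₁))₀ = ℓ(e₁ ⊗ y₁) · u` and `(X (e₂ ⊗ y₂))₀ = ℓ(e₂ ⊗ y₂) · u` with
  `u = (X (e₂ ⊗ t))₀`: the `τ²` coefficient is the hyperplane quad lemma for the block `(0,2)`
  (`SymPencilPerFourHyperplaneQuad.eq_zero_on_ker_of_perm_quad`); the `τ⁰` coefficient kills the coupling term
  of the `τ¹` coefficient (`quad_eq_zero_of_linear_mul`), which then is the hyperplane quad lemma in tensor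
  form for the block `(0,1)` — or, if `ℓ` misses row `1`, the restricted quad lemma
  (`SymPencilPerFourRestrictedQuad.eq_zero_of_perm_quad_mul`); the common vector by density
  (`linear_eq_zero_of_forall_mul`, `eq_zero_of_perm_lin`).

The other rows follow by permuting rows (`SymPencilPerFourHyperplaneFlowTwoRows`).
Elementary; no definitions, no named facts. [folklore]
-/

noncomputable section

-- single-conjunct layout: Sub = Summit, duplicated namespace component intended
set_option linter.dupNamespace false

namespace Summit.ValiantsHypothesis.ValiantsHypothesis.Theorems.SymPencilPerFourHyperplaneFlowBlocks

open Matrix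
open Summit.ValiantsHypothesis.ValiantsHypothesis.Theorems.SymPencilPerFourInnerRankRows
open Summit.ValiantsHypothesis.ValiantsHypothesis.Theorems.SymPencilPerFourRowForms
open Summit.ValiantsHypothesis.ValiantsHypothesis.Theorems.SymPencilPerFourRowNoLinearFactor

variable {K : Type*} [Field K]

/-! ### Two small tools -/

/-- Density: `c(y) · f(y) = 0` for all `y`, `f` linear, `c` a non-zero linear form ⇒ `f = 0`. [folklore] -/
theorem linear_eq_zero_of_forall_mul {M N : Type*} [AddCommGroup M] [Module K M] [AddCommGroup N] [Module K N]
    (c : M →ₗ[K] K) (f : M →ₗ[K] N) {y₀ : M} (hy₀ : c y₀ ≠ 0) (h : ∀ y, c y • f y = 0) : f = 0 := by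
  refine LinearMap.ext fun y => ?_
  by_cases hy : c y = 0
  · have h1 := h (y + y₀)
    have h0 : f y₀ = 0 := by simpa [hy₀] using h y₀
    rw [map_add, hy, zero_add, map_add, h0, add_zero] at h1
    simpa [hy₀] using h1
  · simpa [hy] using h y

/-- `T(d, ·, ·) = 0 ⇒ d = 0`. [folklore] -/
theorem eq_zero_of_perm_lin {v : Fin 4 → K} (hv : ∀ j, v j ≠ 0) [CharZero K] (d : Fin 4 → K)
    (h : ∀ y z : Fin 4 → K, (Matrix.of ![v, d, y, z]).permanent = 0) : d = 0 := by
  funext p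
  by_cases hp : p = 0
  · subst hp
    exact SymPencilPerFourRowStabilizer.eq_zero_of_perm_single hv 1 d (fun z => h _ z) 0 (by decide)
  · exact SymPencilPerFourRowStabilizer.eq_zero_of_perm_single hv 0 d (fun z => h _ z) p hp

/-! ### Compensation in ANOTHER row: the blocks into row `0` from the row-`2` compensation -/

/-- Expansion for the test matrix `y' = (0, y₁, τ y₂ + s t)`, `s = −(L₁ + τ L₂)`, `X y' = B + τ C + s A`:
only the row-`0` term of `DF_v` survives, and it is a cubic in `τ` (no `τ³` term). [folklore] -/
theorem firstOrder_row0via2_expand (v t y₁ y₂ : Fin 4 → K) (A B C : Fin 3 → Fin 4 → K) (L₁ L₂ τ : K) :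
    let s : K := -(L₁ + τ * L₂)
    (Matrix.of ![v, B 0 + τ • C 0 + s • A 0, y₁, τ • y₂ + s • t]).permanent =
    (-L₁ * (Matrix.of ![v, B 0, y₁, t]).permanent + L₁ ^ 2 * (Matrix.of ![v, A 0, y₁, t]).permanent)
    + τ * ((Matrix.of ![v, B 0, y₁, y₂]).permanent - L₂ * (Matrix.of ![v, B 0, y₁, t]).permanent
        - L₁ * (Matrix.of ![v, C 0, y₁, t]).permanent - L₁ * (Matrix.of ![v, A 0, y₁, y₂]).permanent
        + 2 * L₁ * L₂ * (Matrix.of ![v, A 0, y₁, t]).permanent)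
    + τ ^ 2 * ((Matrix.of ![v, C 0, y₁, y₂]).permanent - L₂ * (Matrix.of ![v, C 0, y₁, t]).permanent
        - L₂ * (Matrix.of ![v, A 0, y₁, y₂]).permanent + L₂ ^ 2 * (Matrix.of ![v, A 0, y₁, t]).permanent)
    + τ ^ 3 * 0 := by
  intro s
  simp only [permanent_of_rows, Pi.add_apply, Pi.smul_apply, smul_eq_mul, s]
  ring

/-- **Compensation in row `2`: the three coefficient identities for the blocks into row `0`.** [folklore] -/
theorem row0via2_coeffs [CharZero K] (v : Fin 4 → K) (X : (Fin 3 → Fin 4 → K) →ₗ[K] (Fin 3 → Fin 4 → K))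
    (ℓ : (Fin 3 → Fin 4 → K) →ₗ[K] K) (t : Fin 4 → K) (ht : ℓ (Pi.single 2 t) = 1)
    (hD : ∀ y : Fin 3 → Fin 4 → K, ℓ y = 0 →
      (Matrix.of ![v, X y 0, y 1, y 2]).permanent + (Matrix.of ![v, y 0, X y 1, y 2]).permanent +
        (Matrix.of ![v, y 0, y 1, X y 2]).permanent = 0)
    (y₁ y₂ : Fin 4 → K) :
    let A := X (Pi.single 2 t); let B := X (Pi.single 1 y₁); let C := X (Pi.single 2 y₂)
    let L₁ := ℓ (Pi.single 1 y₁); let L₂ := ℓ (Pi.single 2 y₂)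
    (-L₁ * (Matrix.of ![v, B 0, y₁, t]).permanent + L₁ ^ 2 * (Matrix.of ![v, A 0, y₁, t]).permanent = 0) ∧
    ((Matrix.of ![v, B 0, y₁, y₂]).permanent - L₂ * (Matrix.of ![v, B 0, y₁, t]).permanent
        - L₁ * (Matrix.of ![v, C 0, y₁, t]).permanent - L₁ * (Matrix.of ![v, A 0, y₁, y₂]).permanent
        + 2 * L₁ * L₂ * (Matrix.of ![v, A 0, y₁, t]).permanent = 0) ∧
    ((Matrix.of ![v, C 0, y₁, y₂]).permanent - L₂ * (Matrix.of ![v, C 0, y₁, t]).permanent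
        - L₂ * (Matrix.of ![v, A 0, y₁, y₂]).permanent + L₂ ^ 2 * (Matrix.of ![v, A 0, y₁, t]).permanent = 0) ∧
    ((0 : K) = 0) := by
  intro A B C L₁ L₂
  refine cubic_coeffs_eq_zero _ _ _ _ fun τ => ?_
  set s : K := -(L₁ + τ * L₂) with hs
  set y' : Fin 3 → Fin 4 → K := Pi.single 1 y₁ + Pi.single 2 (τ • y₂ + s • t) with hy'
  have hℓ : ℓ y' = 0 := by
    simp only [hy', map_add, Pi.single_add, Pi.single_smul, map_smul, ht, smul_eq_mul, mul_one]
    show L₁ + (τ * L₂ + s) = 0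
    rw [hs]; ring
  have hXy : X y' = B + τ • C + s • A := by
    simp only [hy', map_add, Pi.single_add, Pi.single_smul, map_smul, A, B, C, add_assoc]
  have h0 : y' 0 = 0 := by simp [hy']
  have h1 : y' 1 = y₁ := by simp [hy']
  have h2 : y' 2 = τ • y₂ + s • t := by simp [hy']
  have h := hD y' hℓ
  rw [hXy, h0, h1, h2, permanent_rows_zero₁, permanent_rows_zero₁, add_zero, add_zero] at h
  simp only [Pi.add_apply, Pi.smul_apply] at h
  rw [firstOrder_row0via2_expand v t y₁ y₂ A B C L₁ L₂ τ] at h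
  linear_combination h

/-- **Blocks into row `0` from the compensation in row `2`.**  If `DF_v(y)[X y] = 0` on `ker ℓ` and
`ℓ(e₂ ⊗ t) = 1` (all `v_j ≠ 0`, characteristic `0`), then with `u := (X (e₂ ⊗ t))₀`:
`(X (e₁ ⊗ y₁))₀ = ℓ(e₁ ⊗ y₁) u` and `(X (e₂ ⊗ y₂))₀ = ℓ(e₂ ⊗ y₂) u` — whatever `ℓ(e₀ ⊗ ·)` is. [folklore] -/
theorem offDiag_row0_via2 [CharZero K] {v : Fin 4 → K} (hv : ∀ j, v j ≠ 0)
    (X : (Fin 3 → Fin 4 → K) →ₗ[K] (Fin 3 → Fin 4 → K)) (ℓ : (Fin 3 → Fin 4 → K) →ₗ[K] K)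
    (t : Fin 4 → K) (ht : ℓ (Pi.single 2 t) = 1)
    (hD : ∀ y : Fin 3 → Fin 4 → K, ℓ y = 0 →
      (Matrix.of ![v, X y 0, y 1, y 2]).permanent + (Matrix.of ![v, y 0, X y 1, y 2]).permanent +
        (Matrix.of ![v, y 0, y 1, X y 2]).permanent = 0) :
    (∀ y₁, X (Pi.single 1 y₁) 0 = ℓ (Pi.single 1 y₁) • X (Pi.single 2 t) 0) ∧
      (∀ y₂, X (Pi.single 2 y₂) 0 = ℓ (Pi.single 2 y₂) • X (Pi.single 2 t) 0) := by
  classical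
  let ℓ₁ : (Fin 4 → K) →ₗ[K] K := ℓ ∘ₗ LinearMap.single K (fun _ : Fin 3 => Fin 4 → K) 1
  let ℓ₂ : (Fin 4 → K) →ₗ[K] K := ℓ ∘ₗ LinearMap.single K (fun _ : Fin 3 => Fin 4 → K) 2
  let Y₁ : (Fin 4 → K) →ₗ[K] (Fin 4 → K) :=
    (LinearMap.proj 0) ∘ₗ X ∘ₗ LinearMap.single K (fun _ : Fin 3 => Fin 4 → K) 1
  let Y₂ : (Fin 4 → K) →ₗ[K] (Fin 4 → K) :=
    (LinearMap.proj 0) ∘ₗ X ∘ₗ LinearMap.single K (fun _ : Fin 3 => Fin 4 → K) 2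
  have hℓ₁ : ∀ y, ℓ₁ y = ℓ (Pi.single 1 y) := fun _ => rfl
  have hℓ₂ : ∀ y, ℓ₂ y = ℓ (Pi.single 2 y) := fun _ => rfl
  have hY₁ : ∀ y, Y₁ y = X (Pi.single 1 y) 0 := fun _ => rfl
  have hY₂ : ∀ y, Y₂ y = X (Pi.single 2 y) 0 := fun _ => rfl
  set A := X (Pi.single 2 t) with hA
  have hℓ₂t : ℓ₂ t = 1 := by rw [hℓ₂, ht]
  -- STEP 2 first: `Y₂` vanishes on `ker ℓ₂`, hence `Y₂ y = ℓ₂ y • A 0`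
  have hY₂ker : ∀ y, ℓ₂ y = 0 → Y₂ y = 0 :=
    SymPencilPerFourHyperplaneQuad.eq_zero_on_ker_of_perm_quad hv Y₂ ℓ₂ fun y₂ y₁ hy₂ => by
      obtain ⟨-, -, c2, -⟩ := row0via2_coeffs v X ℓ t ht hD y₁ y₂
      rw [← hℓ₂, hy₂] at c2
      rw [hY₂, per_swap_row₂₃]
      linear_combination c2
  have hX02 : ∀ y₂, X (Pi.single 2 y₂) 0 = ℓ (Pi.single 2 y₂) • A 0 := by
    intro y₂
    have h1 := hY₂ker (y₂ - ℓ₂ y₂ • t) (by rw [map_sub, map_smul, hℓ₂t, smul_eq_mul, mul_one, sub_self])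
    rw [map_sub, map_smul, sub_eq_zero, hY₂, hY₂, hℓ₂] at h1
    exact h1
  refine ⟨?_, hX02⟩
  -- STEP 1: the block `X₀₁`
  by_cases h1 : ℓ₁ = 0
  · -- `ℓ(e₁ ⊗ ·) = 0`: the τ¹ identity is an RQL-mul shape
    have hY10 : Y₁ = 0 := by
      refine SymPencilPerFourRestrictedQuad.eq_zero_of_perm_quad_mul hv Y₁ ℓ₂
        (fun y₁ => (Matrix.of ![v, X (Pi.single 1 y₁) 0, y₁, t]).permanent) fun y₁ y₂ => ?_
      obtain ⟨-, c1, -, -⟩ := row0via2_coeffs v X ℓ t ht hD y₁ y₂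
      have h0 : ℓ (Pi.single 1 y₁) = 0 := by rw [← hℓ₁, h1, LinearMap.zero_apply]
      rw [h0] at c1
      rw [hY₁, hℓ₂]
      linear_combination c1
    intro y₁
    rw [← hY₁, hY10, LinearMap.zero_apply, ← hℓ₁, h1, LinearMap.zero_apply, zero_smul]
  · obtain ⟨y₀, hy₀⟩ : ∃ y₀, ℓ₁ y₀ ≠ 0 := by
      by_contra h0; push Not at h0; exact h1 (LinearMap.ext h0)
    -- quad-kill on the `τ⁰` coefficient
    let Bq : (Fin 4 → K) →ₗ[K] (Fin 4 → K) →ₗ[K] K :=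
      LinearMap.mk₂ K (fun y y' => ℓ₁ y * (Matrix.of ![v, A 0, y', t]).permanent
          - (Matrix.of ![v, X (Pi.single 1 y') 0, y, t]).permanent)
        (fun y y' z => by simp only [map_add, per_add_row₂]; ring)
        (fun c y z => by simp only [map_smul, smul_eq_mul, per_smul_row₂]; ring)
        (fun y z z' => by
          simp only [Pi.single_add, map_add, Pi.add_apply, per_add_row₁, per_add_row₂]; ring)
        (fun c y z => by
          simp only [Pi.single_smul, map_smul, Pi.smul_apply, smul_eq_mul, permanent_rows_smul₁, per_smul_row₂]; ring)
    have hR : ∀ y₁, (Matrix.of ![v, X (Pi.single 1 y₁) 0, y₁, t]).permanent =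
        ℓ₁ y₁ * (Matrix.of ![v, A 0, y₁, t]).permanent := by
      intro y₁
      have hq := quad_eq_zero_of_linear_mul ℓ₁ Bq (fun y => by
        obtain ⟨c0, -, -, -⟩ := row0via2_coeffs v X ℓ t ht hD y y₀
        simp only [Bq, LinearMap.mk₂_apply, hℓ₁]
        linear_combination c0) hy₀ y₁
      simp only [Bq, LinearMap.mk₂_apply] at hq
      linear_combination -hq
    -- the τ¹ identity becomes `T(Y₁ y₁, y₁, y₂) = ℓ₁(y₁) · T(A 0, y₁, y₂)`
    have hq1 : ∀ y₁ y₂, (Matrix.of ![v, Y₁ y₁, y₁, y₂]).permanent =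
        ℓ₁ y₁ * (Matrix.of ![v, A 0, y₁, y₂]).permanent := by
      intro y₁ y₂
      obtain ⟨-, c1, -, -⟩ := row0via2_coeffs v X ℓ t ht hD y₁ y₂
      have hR1 := hR y₁
      have hC := hX02 y₂
      rw [hℓ₁] at hR1
      rw [hY₁, hℓ₁]
      rw [hC, permanent_rows_smul₁] at c1
      linear_combination c1 + ℓ (Pi.single 2 y₂) * hR1
    obtain ⟨u₁, hu₁⟩ := SymPencilPerFourHyperplaneQuad.exists_eq_smul_of_perm_quad_hyperplane hv Y₁ ℓ₁
      (fun y₁ y₂ => (Matrix.of ![v, A 0, y₁, y₂]).permanent) hq1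
    -- `u₁ = A 0` by density
    have hd : ∀ y₁ y₂, ℓ₁ y₁ * (Matrix.of ![v, u₁ - A 0, y₁, y₂]).permanent = 0 := by
      intro y₁ y₂
      have e1 := hq1 y₁ y₂
      rw [hu₁, permanent_rows_smul₁] at e1
      rw [show u₁ - A 0 = u₁ + (-1 : K) • A 0 by rw [neg_one_smul, sub_eq_add_neg], per_add_row₁, permanent_rows_smul₁]
      linear_combination e1
    have h3 : ∀ y₁ y₂, (Matrix.of ![v, u₁ - A 0, y₁, y₂]).permanent = 0 := by
      intro y₁ y₂
      let g : (Fin 4 → K) →ₗ[K] K := (LinearMap.mk₂ K (fun a b : Fin 4 → K => (Matrix.of ![v, u₁ - A 0, a, b]).permanent)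
          (fun a a' b => per_add_row₂ _ _ _ _ _) (fun c a b => per_smul_row₂ _ _ _ _ _)
          (fun a b b' => per_add_row₃ _ _ _ _ _) (fun c a b => per_smul_row₃ _ _ _ _ _)).flip y₂
      have hg : ∀ a, g a = (Matrix.of ![v, u₁ - A 0, a, y₂]).permanent := fun a => rfl
      have key := linear_eq_zero_of_forall_mul ℓ₁ g hy₀ fun y => by rw [hg, smul_eq_mul]; exact hd y y₂
      have := LinearMap.congr_fun key y₁
      rwa [hg, LinearMap.zero_apply] at this
    have hu : u₁ = A 0 := by
      have := eq_zero_of_perm_lin hv (u₁ - A 0) h3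
      rwa [sub_eq_zero] at this
    intro y₁
    rw [← hY₁, hu₁, hℓ₁, hu]

end Summit.ValiantsHypothesis.ValiantsHypothesis.Theorems.SymPencilPerFourHyperplaneFlowBlocks

end
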